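import Summits.AtomisticToContinuum.Crystallization.Theorems.FrustratedLawDichotomyStrainedPatchHomEntryFitHcpRotKit

/-!
# The CENTRED fit verdict WITH THE ROTATION PAYLOAD, kit: `fitOKHDCR c w q` = `…CentredKit.fitOKHD` against the rotated pattern `Q n_k`, minimising scales only
# (27623 `(H) HomFloor (1/625)`, hcp half; hand-1 g31 FINDING §5: «2⁻¹² throughout needs the centred kit with the rotated pattern»)

decomp-a2c hand-1 g31 (crux `AperiodicFrustratedLawGap`, stmt-AtomisticToContinuum-27623).  With the rotation payload `q` (`…RotKit.cayQ`, `qnFI`) the pair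
residual is `N_k − ‖N_{k′}‖·Q n_k = (R_k + λ(n_k − Q n_k)) − (δ_{k′})·Q n_k`: relative to `…HomEntryFitCentredReal.pairResidual_le` the box variation
`ΔR_k = R_k − R_{c,k}` and `ΔN` are UNCHANGED (the rotation only moves centre/constant data), so the centred kit carries over with three edits: the centre
residual `cRcvR = cRc + λ(nbrFI − qnFI) − cDlt·qnFI`, its norm / direction `cRcNR` / `cEhR`, and the direction cosine `⟪ê, Q n_k⟫ = dot3 e (qnFI q k)` in
`cPairCoreR`; `cPairCR`, `cPairTR`, `cPairOKR` and ★ `fitOKHDCR` (with the `possMinH` filter of `…MinPairs` and `0 < cayN q`) follow.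
Soundness: `…HomEntryFitHcpCentredRotPair`.

All definitions computable; 0 sorry; standard axioms; no instances / notation / `#eval`.  `--supports stmt-AtomisticToContinuum-27623`.
-/

namespace Summit.AtomisticToContinuum.Crystallization.Theorems.FrustratedLawDichotomyStrainedPatchHomEntryFitHcpCentred

open Literature.Analysis.ValidatedNumerics.Numerics
open Summit.AtomisticToContinuum.Crystallization.Theorems.FrustratedLawDichotomyStrainedPatchHomEntryGramHcp (dot3 shufFI)
open Summit.AtomisticToContinuum.Crystallization.Theorems.FrustratedLawDichotomyStrainedPatchHomEntryFit (scaleL devFI lmax)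
open Summit.AtomisticToContinuum.Crystallization.Theorems.FrustratedLawDichotomyStrainedPatchHomEntryFitKit (lmin)
open Summit.AtomisticToContinuum.Crystallization.Theorems.FrustratedLawDichotomyStrainedPatchHomEntryHcpFrame (hlab hshift nbr)
open Summit.AtomisticToContinuum.Crystallization.Theorems.FrustratedLawDichotomyStrainedPatchHomEntryFitHcpKit (dEnclH nbrSq xiSq box7all qform13 extU K12H)
open Summit.AtomisticToContinuum.Crystallization.Theorems.FrustratedLawDichotomyStrainedPatchHomEntryFitHcpSharpKit (nbrFI rVec nrm2 dlt devH d2S)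

/-- Centre residual components of the ROTATED pair fit: `(R_c)_a + λ((n_k)_a − (Q n_k)_a) − δ_c·(Q n_k)_a`. -/
def cRcvR (c : (Fin 3 × Fin 3) ⊕ Fin 3 → ℤ) (L : ℤ) (q : Fin 4 → ℤ) (k k' : Fin 12) (a : Fin 3) : FI :=
  ((cRc c L k a).add ((FI.ofScaled L).mul ((nbrFI k a).sub (qnFI q k a)))).sub ((cDlt c L k').mul (qnFI q k a))

/-- `‖r_c‖` for the rotated pattern. -/
def cRcNR (c : (Fin 3 × Fin 3) ⊕ Fin 3 → ℤ) (L : ℤ) (q : Fin 4 → ℤ) (k k' : Fin 12) : FI := FI.sqrt (dot3 (cRcvR c L q k k') (cRcvR c L q k k'))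

/-- `ê` for the rotated pattern. -/
def cEhR (c : (Fin 3 × Fin 3) ⊕ Fin 3 → ℤ) (L : ℤ) (q : Fin 4 → ℤ) (k k' : Fin 12) (a : Fin 3) : Option FI := FI.divPos (cRcvR c L q k k' a) (cRcNR c L q k k')

/-- The CENTRED pair bound from direction data `e ∋ ê`, `g ∋ ĝ` against the ROTATED pattern (`…CentredKit.cPairCore` with `⟪ê, Q n_k⟫` and `cRcNR`). -/
def cPairCoreR (c w : (Fin 3 × Fin 3) ⊕ Fin 3 → ℤ) (L : ℤ) (q : Fin 4 → ℤ) (k k' : Fin 12) (e g : Fin 3 → FI) : Option FI :=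
  (FI.divPos ((absFI (dot3 e (qnFI q k))).mul (cRho c w k').sqr) (((cNcN c L k').sub (cRho c w k')).mulInt 2)).bind fun q1 =>
    (FI.divPos (((cRho c w k).add (cRho c w k')).sqr) (((cRcNR c L q k k').sub ((cRho c w k).add (cRho c w k'))).mulInt 2)).bind fun q2 =>
      some ((((cRcNR c L q k k').add ((cTU c w k k' e g (dot3 e (qnFI q k))).add (cTX c w k k' e g (dot3 e (qnFI q k))))).add q1).add q2)

/-- The centred rotated pair bound (none if a guard fails). -/
def cPairCR (c w : (Fin 3 × Fin 3) ⊕ Fin 3 → ℤ) (L : ℤ) (q : Fin 4 → ℤ) (k k' : Fin 12) : Option FI :=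
  (vec3? (cEhR c L q k k')).bind fun e => (vec3? (cGh c L k')).bind fun g => cPairCoreR c w L q k k' e g

/-- The guard-free triangle bound `‖r_c‖ + ρ_k + ρ_{k′}` with the rotated centre residual. -/
def cPairTR (c w : (Fin 3 × Fin 3) ⊕ Fin 3 → ℤ) (L : ℤ) (q : Fin 4 → ℤ) (k k' : Fin 12) : ℤ := (cRcNR c L q k k').hi + (cRho c w k).hi + (cRho c w k').hi

/-- The rotated pair test: triangle bound passes, or the centred rotated bound exists and passes. -/
def cPairOKR (c w : (Fin 3 × Fin 3) ⊕ Fin 3 → ℤ) (L : ℤ) (q : Fin 4 → ℤ) (k k' : Fin 12) : Bool :=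
  cTest (d2S c w L) (cPairTR c w L q k k') || (cPairCR c w L q k k').elim false fun B => cTest (d2S c w L) B.hi

/-- ★ **THE CENTRED hcp (P1) FIT VERDICT WITH THE ROTATION PAYLOAD `q`** (`fitOKHD` with `cPairOKR`, the `possMinH` filter and `0 < cayN q`). -/
def fitOKHDCR (c w : (Fin 3 × Fin 3) ⊕ Fin 3 → ℤ) (q : Fin 4 → ℤ) : Bool :=
  let L := scaleL (fun ab => c (Sum.inl ab))
  let D := dEnclH c w
  decide (c (Sum.inl (1, 0)) = c (Sum.inl (0, 1)) ∧ c (Sum.inl (2, 0)) = c (Sum.inl (0, 2)) ∧ c (Sum.inl (2, 1)) = c (Sum.inl (1, 2))) &&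
  decide (0 ≤ L) && decide (0 < D.lo) && decide (D.lo ≤ D.hi) && decide (2 * D.hi ≤ 3 * (SC : ℤ)) &&
  decide ((SC : ℤ) ≤ 130 * D.lo) && decide (4 * (xiSq c w).hi ≤ (SC : ℤ)) &&
  decide (0 < cayN q) && K12H.all (fun k => K12H.all fun k' => !possMinH c w k' || cPairOKR c w L q k k') &&
  K12H.all (fun k => decide ((nbrSq c w k).hi * SC * 10000 ≤ (130 * D.lo - SC) ^ 2)) &&
  decide (∀ b ∈ box7all,
    (b = 0 ∨ (∃ k : Fin 12, hshift k = false ∧ hlab k = b) ∨ (130 * D.hi + (SC : ℤ)) ^ 2 ≤ (qform13 (extU c w) b false).lo * SC * 10000) ∧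
    ((∃ k : Fin 12, hshift k = true ∧ hlab k = b) ∨ (130 * D.hi + (SC : ℤ)) ^ 2 ≤ (qform13 (extU c w) b true).lo * SC * 10000))

end Summit.AtomisticToContinuum.Crystallization.Theorems.FrustratedLawDichotomyStrainedPatchHomEntryFitHcpCentred
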